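import Summits.ValiantsHypothesis.ValiantsHypothesis.Theorems.LacunarySymmetroidMatrixDescartesDoorA26WallBubblingMixThree
import Summits.ValiantsHypothesis.ValiantsHypothesis.Theorems.LacunarySymmetroidMatrixDescartesDoorA26WallBubblingTwoPairChainSym
import Summits.ValiantsHypothesis.ValiantsHypothesis.Theorems.LacunarySymmetroidMatrixDescartesDoorA26WallBubblingDoublyConfluentNondeg

/-!
# Wall bubbling for `DoorA26` — THE VALUE-GENERIC TWO-PAIR STRATUM: NO ACCUMULATION OF TWENTIES (door-free)

HONEST FRAMING.  Obligation (W) `stub_weylFaces` of `Cruxes/DoorA26/Lines/wall_bubbling.lean` (crux `DoorA26`, stmt-ValiantsHypothesis-19979; OPEN,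
typed, never asserted); statement file `Cruxes/DoorA26/Lines/wall_bubbling_ConfluentDoor.lean` rev 7 ff. types the hypothesis
`ValueGenericTwoPairChain26` of the (W_deepVal) reduction `weylFaces_deepVal_of_chains'` (W1 #44): «no sequence of genuine `(2,6)` pencils with
twenty log-zeros at every stage has exponents converging to a VALUE-GENERIC point with exactly two Weyl pairs».  W1 seat val-sym-door-p2 g14 (#63):

* **`valueGenericTwoPairChain : ‹body of ValueGenericTwoPairChain26 verbatim›`** — immediate from W1 #61 `twoPair_noTwenties_of_mixedRules'`
  fed with the three proved mixed-class rules (W1 #54 `mixTop_face`, #55 `mixMid_face`, #60 `mixThree_face'`), the value-generic coincidence pattern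
  (`hvg ↦ Or.inl / Or.inr ∘ Or.inl`) and the value-generic non-degeneracy W1 #26 `doublyConfluentDet_ne_zero_of_polar_ne_zero`.  Link for the line
  file: `ValueGenericTwoPairChain26_holds : ValueGenericTwoPairChain26 := valueGenericTwoPairChain`.

With this, (W_deepVal) ⟸ `ValueGenericThreePairChain26` ∧ `TripleStratum26` (both OPEN: three-dslope port; triple anatomy).  Registers unchanged;
(W), `ConfluentDoor26`, `NoTightChain26(NC)`, (M), `DoorA26` 19979, 18050 OPEN, typed never asserted; nothing on VP ≠ VNP.  Def-free.
`--supports stmt-ValiantsHypothesis-19979 --as helper`.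
-/

-- `Summit.ValiantsHypothesis.ValiantsHypothesis.…` repeats a component by the D-0017 layout
-- (single-conjunct summit), which the `dupNamespace` linter flags; the name is mandated.
set_option linter.dupNamespace false

namespace Summit.ValiantsHypothesis.ValiantsHypothesis.Theorems.LacunarySymmetroidMatrixDescartes.WallBubbling

open Finset Filter Topology
open Bubbling (polar)
open scoped BigOperators

/-- **THE VALUE-GENERIC TWO-PAIR CHAIN** (`ValueGenericTwoPairChain26` of the line file, verbatim body): at a value-generic point with two Weyl
pairs (`δ0 5 = δ0 0`, `δ0 4 = δ0 1`, only trivial coincidences among the four values) twenties do not accumulate along any sequence of genuine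
symmetric `(2,6)` pencils.  Door-free, hypothesis-free. [this work] -/
theorem valueGenericTwoPairChain :
    ∀ (δs : ℕ → Fin 6 → ℝ) (δ0 : Fin 6 → ℝ), (∀ l, Tendsto (fun ν => δs ν l) atTop (𝓝 (δ0 l))) →
      δ0 5 = δ0 0 → δ0 4 = δ0 1 →
      (∀ a b c d : Fin 4, δ0 a.castSucc.castSucc + δ0 b.castSucc.castSucc = δ0 c.castSucc.castSucc + δ0 d.castSucc.castSucc →
        (a = c ∧ b = d) ∨ (a = d ∧ b = c)) →
      ∀ (U : ℕ → Fin 6 → Matrix (Fin 2) (Fin 2) ℝ), (∀ ν l, (U ν l).IsSymm) →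
      (∀ ν, ∃ t, (∑ l, Real.exp (δs ν l * t) • U ν l).det ≠ 0) →
      ∀ (z : ℕ → Fin 20 → ℝ), (∀ ν, StrictMono (z ν)) → (∀ ν i, (∑ l, Real.exp (δs ν l * z ν i) • U ν l).det = 0) → False :=
  fun δs δ0 hδ0 h50 h41 hvg U hU hne z hz hroot =>
    twoPair_noTwenties_of_mixedRules' δ0 h50 h41 (mixTop_face δ0 h50 h41) (mixMid_face δ0 h50 h41) (mixThree_face' δ0 h50 h41)
      (fun a b c e h => (hvg a b c e h).elim Or.inl (fun x => Or.inr (Or.inl x)))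
      (fun W hWs hW' => doublyConfluentDet_ne_zero_of_polar_ne_zero δ0 h50 h41 hvg W hWs hW')
      δs hδ0 U hU hne z hz hroot

end Summit.ValiantsHypothesis.ValiantsHypothesis.Theorems.LacunarySymmetroidMatrixDescartes.WallBubbling
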